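import Summits.CriticalPhenomena.PercolationContinuityZ3.Theses.PercSupergraphDichotomy
import Summits.CriticalPhenomena.PercolationContinuityZ3.Theorems.PercNearOneGluingNoHeavyLowerTailCSHTheoremOne
import HarnessLib

/-!
# `PercSupergraphDichotomy.DichotomyLink` (stmt-CriticalPhenomena-11905) — SETTLED after continuity

Item `stmt-CriticalPhenomena-11905` of route `CriticalPhenomena/PercSupergraphDichotomy` (support (glue)): `CCDGraphZ3 ↔ ¬ SupergraphContinuity`.

The two horns are exact negations of each other (`θ ≥ 0` turns `θ ≠ 0` into `0 < θ`).  p205010 is NOT used.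

builds on p205010 (kernel theorem, internal audit signed; external expert review pending) — USED (`CSH.percolationContinuityZ3_holds`).  RSW3 lane, lead gen 28 (prover-prim-rsw3-lead-g28-0):
'after continuity — the ledger harvest'.
References: G. Kozma, N. Nitzan (2024), Thm. 6 / Conj. 3 [KozmaNitzan2024]; G. Grimmett, *Percolation* (1999), §8 [GrimmettPercolation1999].
-/

noncomputable section

namespace Summit.CriticalPhenomena.PercolationContinuityZ3.Theorems

namespace PercSupergraphDichotomyDichotomyLink

open MeasureTheory Literature.Probability.Percolation Literature.Probability.LatticeModels

/-- **`PercSupergraphDichotomy.DichotomyLink` (stmt-CriticalPhenomena-11905), settled.**  pure logic plus `measureReal_nonneg`.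
[cite: KozmaNitzan2024, Thm. 6 with Conj. 3 (p. 15)] -/
theorem dichotomyLink_proof : Summit.CriticalPhenomena.PercolationContinuityZ3.Theses.PercSupergraphDichotomy.DichotomyLink := by
  unfold Summit.CriticalPhenomena.PercolationContinuityZ3.Theses.PercSupergraphDichotomy.DichotomyLink Summit.CriticalPhenomena.PercolationContinuityZ3.Theses.PercSupergraphDichotomy.CCDGraphZ3
    Summit.CriticalPhenomena.PercolationContinuityZ3.Theses.PercSupergraphDichotomy.SupergraphContinuity
  constructor
  · rintro ⟨G, h1, h2, h3, hθ⟩ hS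
    exact absurd (hS G h1 h2 h3) (ne_of_gt hθ)
  · intro hS
    by_contra hC
    apply hS
    intro G h1 h2 h3
    by_contra hne
    exact hC ⟨G, h1, h2, h3, lt_of_le_of_ne (by unfold theta; exact measureReal_nonneg) (Ne.symm hne)⟩

end PercSupergraphDichotomyDichotomyLink

end Summit.CriticalPhenomena.PercolationContinuityZ3.Theorems

end
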